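import Summits.Ventures.PercRepro.S1TailJ4
import Summits.Ventures.PercRepro.S1LevelFourF

/-!
# PercRepro — S1 LEVEL FOUR, PHASE 7: C-025 at level `4` for every finite matroid and every `p ≥ 15` (p2, gen 15;
SUBCLAIM-S1 with LEMMAS J, J′, K and p1 g20's LEMMA T⁺⁺⁺)

The cell inequality with Lemma T⁺⁺⁺ (`S1CellTableJ4.cellOK6`: `s₃ ≤ (d² + 6 − 3d)/2`, p1 g20's `S1TrianglePlusSharp`,
on top of Lemmas J, J′, K) closes every core cell `(p, d)` with `15 ≤ p ≤ 16`: `5 ≤ d ≤ 15` by `table_15_16`,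
`16 ≤ d ≤ 400` by `table_15_16_16_400`, `d ≥ 401` by `cellOK6_of_tail`. With the cores of rank `≥ 17`
(`S1LevelFourF.c025_core_four_all_corank17`) the `e`-free core is closed at EVERY `p ≥ 15` and every corank, so
`ThmN.rls_succ_large 3 4 15` gives level `4` at every `p ≥ 16` and `S1FixedFrame.rls_succ_fixed 3 4 15` gives `p = 15`.

* `c025_core_four_cellT` — the core cells `15 ≤ p ≤ 16`, every `d ≥ 5`;
* `c025_core_four_all_corank15` — the core at every `p ≥ 15`, every corank `≥ 5`;
* `c025_four_sixteen` — `ThmN.RLS M p 4` for `p ≥ 16`; `c025_four_fifteen_fixed` — at `p = 15`;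
* **`c025_four_fifteen`** — THE END THEOREM: `ThmN.RLS M p 4` for every finite matroid and every `p ≥ 15`;
  `c025_four_fifteen'` — the literal `C025` body.
Axioms: standard.
-/

open scoped Matroid

namespace PercRepro

namespace S1

variable {α : Type}

/-- **The Lemma-T⁺⁺⁺ core cells `15 ≤ p ≤ 16`, every corank `d ≥ 5`.** -/
theorem c025_core_four_cellT (M : Matroid α) [M.Finite] (p d : ℕ) (hp : 15 ≤ p) (hp' : p ≤ 16)
    (hd : 5 ≤ d) (hR : M.eRank = (p : ℕ∞)) (hn : M.E.ncard = p + d)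
    (hfree : ∀ e ∈ M.E, ∃ A ⊆ M.E \ {e}, e ∉ M.closure A ∧ e ∉ M.closure ((M.E \ {e}) \ A)) :
    ThmN.RLS M p 4 := by
  rcases Nat.lt_or_ge d 16 with h16 | h16
  · exact rls_of_cellOK6 M p d (by omega) hR hn hfree (by omega) (table_15_16 p hp hp' d hd (by omega))
  rcases Nat.lt_or_ge d 401 with h401 | h401
  · exact rls_of_cellOK6 M p d (by omega) hR hn hfree (by omega) (table_15_16_16_400 p (by omega) hp d h401 h16)
  · exact rls_of_cellOK6 M p d (by omega) hR hn hfree (by omega) (cellOK6_of_tail p d hp hp' h401)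

/-- **The `e`-free core at rank `p ≥ 15` and every corank `≥ 5`.** -/
theorem c025_core_four_all_corank15 (M : Matroid α) [M.Finite] (p : ℕ) (hp : 15 ≤ p)
    (hR : M.eRank = (p : ℕ∞)) (hbig : p + 4 < M.E.ncard)
    (hfree : ∀ e ∈ M.E, ∃ A ⊆ M.E \ {e}, e ∉ M.closure A ∧ e ∉ M.closure ((M.E \ {e}) \ A)) :
    ThmN.RLS M p 4 := by
  rcases Nat.lt_or_ge p 17 with h16 | h17
  · exact c025_core_four_cellT M p (M.E.ncard - p) hp (by omega) (by omega) hR (by omega) hfree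
  · exact c025_core_four_all_corank17 M p h17 hR hbig hfree

/-- **Level `4` for every `p ≥ 16`** (night-1's wrapper at threshold `15`). -/
theorem c025_four_sixteen (M : Matroid α) [M.Finite] (p : ℕ) (hp : 16 ≤ p) : ThmN.RLS M p 4 := by
  refine ThmN.rls_succ_large (α := α) 3 4 15 ?_ ?_ ?_ M p hp (by omega)
  · intro M' _ p' _ hp'
    exact SevenThree.c025_three_all M' p' (by omega)
  · intro M' _ p' _ hn _
    rcases Nat.lt_or_ge M'.E.ncard (p' + 4) with h | h
    · exact ThmN.RLS_of_ncard_lt M' h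
    · exact ThmN.RLS_of_ncard_eq M' (by omega)
  · intro M' _ p' hP hR hbig _ hfree
    exact c025_core_four_all_corank15 M' p' hP hR hbig hfree

/-- **Level `4` at rank `15`** (the fixed-rank frame). -/
theorem c025_four_fifteen_fixed (M : Matroid α) [M.Finite] : ThmN.RLS M 15 4 := by
  refine rls_succ_fixed (α := α) 3 4 15 (by omega) ?_ ?_ ?_ M
  · intro M' _
    exact SevenThree.c025_three_all M' 14 (by omega)
  · intro M' _ hn
    rcases Nat.lt_or_ge M'.E.ncard (15 + 4) with h | h
    · exact ThmN.RLS_of_ncard_lt M' h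
    · exact ThmN.RLS_of_ncard_eq M' (by omega)
  · intro M' _ hR hbig hfree
    exact c025_core_four_all_corank15 M' 15 (le_refl _) hR hbig hfree

/-- **THE END THEOREM OF PHASE 7**: every finite matroid satisfies C-025 at level `4` for every `p ≥ 15`:
`Φ(p, 4)·#{A ⊆ E : r(A) = p, r(E ∖ A) = 4} ≤ #{A ⊆ E : 4 < r(A) < p}`. -/
theorem c025_four_fifteen (M : Matroid α) [M.Finite] (p : ℕ) (hp : 15 ≤ p) : ThmN.RLS M p 4 := by
  rcases Nat.lt_or_ge p 16 with h | h
  · have hp15 : p = 15 := by omega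
    subst hp15
    exact c025_four_fifteen_fixed M
  · exact c025_four_sixteen M p h

/-- The phase-7 theorem in the literal vocabulary of `C025` (the body at `(p, 4)`). -/
theorem c025_four_fifteen' (M : Matroid α) [M.Finite] (p : ℕ) (hp : 15 ≤ p) :
    phiK p 4 * ({A : Set α | A ⊆ M.E ∧ M.eRk A = (p : ℕ∞) ∧ M.eRk (M.E \ A) = (4 : ℕ∞)}.ncard : ℚ) ≤
      ({A : Set α | A ⊆ M.E ∧ (4 : ℕ∞) < M.eRk A ∧ M.eRk A < (p : ℕ∞)}.ncard : ℚ) :=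
  c025_four_fifteen M p hp

end S1

end PercRepro
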